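import Literature.Topology.FourManifolds.DoublePointPersistence
import Literature.Analysis.Calculus.MixedPartials
import HarnessLib

/-!
# Transverse double points persist with differentiable tracks

Companion of `DoublePointPersistence.lean` (towards the named fact `Knot.reidemeisterR`, analysis
of the elementary events of the direction `→`): the tracks `σ, υ` of the two parameters of a
transverse double point of a `C¹` family of plane curves (`exists_doublePoint_track`) are
differentiable at the base time, with velocities `σ', υ'` solving the linearised double-point
equation
`∂ₜγ (t₀, a) + σ' • γ_{t₀}' (a) = ∂ₜγ (t₀, b) + υ' • γ_{t₀}' (b)`
(`exists_doublePoint_track_hasDerivAt`; the derivative of the local inverse of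
`(t, s, u) ↦ (t, γ t s - γ t u)` at `(t₀, 0)`, `HasStrictFDerivAt.to_localInverse`). These
velocities enter the non-degeneracy conditions of the events of a generic isotopy of knot
projections (third move: the two crossings on an arc swap their order with non-zero relative
speed). The construction of `exists_doublePoint_track` is repeated (its tracks are existentially
quantified). Everything here is proved; no named facts.

## References

* V. Guillemin, A. Pollack, *Differential Topology* (1974), Ch. 1 §6 (stability of transversal
  intersection). [cite: GuilleminPollack2010, Ch. 1 §6]
-/

open Function Set Filter Metric Topology

noncomputable section

namespace Literature.Topology.FourManifolds

open DoublePointPersistence in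
/-- **Transverse double points persist, with differentiable tracks.** Let `γ : ℝ → ℝ → ℝ × ℝ` be
jointly `Cⁿ`, `n ≥ 1`, and `(a, b)` a transverse double point of `γ t₀`. Then, as in
`exists_doublePoint_track`, for some `δ > 0` continuous tracks `σ, υ` on `(t₀ - δ, t₀ + δ)` with
`σ t₀ = a`, `υ t₀ = b` follow the unique nearby double point `γ t (σ t) = γ t (υ t)`; moreover
`σ, υ` are differentiable at `t₀` with derivatives `σ', υ'` satisfying
`∂ₜγ (t₀, a) + σ' • γ_{t₀}' a = ∂ₜγ (t₀, b) + υ' • γ_{t₀}' b`, which determines them by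
transversality. Guillemin–Pollack (1974), Ch. 1 §6. [cite: GuilleminPollack2010, Ch. 1 §6] -/
theorem exists_doublePoint_track_hasDerivAt {γ : ℝ → ℝ → ℝ × ℝ} {n : WithTop ℕ∞}
    (hγ : ContDiff ℝ n (uncurry γ)) (hn : n ≠ 0) {t₀ a b : ℝ} (hab : γ t₀ a = γ t₀ b)
    (hdet : (deriv (γ t₀) a).1 * (deriv (γ t₀) b).2 - (deriv (γ t₀) a).2 * (deriv (γ t₀) b).1 ≠ 0) :
    ∃ (δ : ℝ) (σ υ : ℝ → ℝ) (σ' υ' : ℝ), 0 < δ ∧ ContinuousOn σ (Ioo (t₀ - δ) (t₀ + δ)) ∧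
      ContinuousOn υ (Ioo (t₀ - δ) (t₀ + δ)) ∧ σ t₀ = a ∧ υ t₀ = b ∧
      HasDerivAt σ σ' t₀ ∧ HasDerivAt υ υ' t₀ ∧
      deriv (fun t ↦ γ t a) t₀ + σ' • deriv (γ t₀) a
        = deriv (fun t ↦ γ t b) t₀ + υ' • deriv (γ t₀) b ∧
      (∀ t, |t - t₀| < δ → γ t (σ t) = γ t (υ t)) ∧
      ∀ t s u, |t - t₀| < δ → |s - a| < δ → |u - b| < δ → γ t s = γ t u → s = σ t ∧ u = υ t := by
  set p₀ : ℝ × (ℝ × ℝ) := (t₀, (a, b)) with hp₀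
  have hΨ : HasStrictFDerivAt (psi γ)
      ((psiDerivEquiv hγ hn hdet : (ℝ × (ℝ × ℝ)) ≃L[ℝ] (ℝ × (ℝ × ℝ))) : ℝ × (ℝ × ℝ) →L[ℝ] ℝ × (ℝ × ℝ))
      p₀ := by
    rw [coe_psiDerivEquiv]
    exact hasStrictFDerivAt_psi hγ hn p₀
  set Φ := hΨ.toOpenPartialHomeomorph (psi γ) with hΦ
  have hΦf : (Φ : ℝ × (ℝ × ℝ) → ℝ × (ℝ × ℝ)) = psi γ := hΨ.toOpenPartialHomeomorph_coe
  have hsrc : p₀ ∈ Φ.source := hΨ.mem_toOpenPartialHomeomorph_source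
  have htgt : psi γ p₀ ∈ Φ.target := hΨ.image_mem_toOpenPartialHomeomorph_target
  have hΨ₀ : psi γ p₀ = (t₀, 0) := by
    simp only [psi, hp₀, hab, sub_self]
  -- radii: `r` for the target around `(t₀, 0)`, `r'` for the source around `p₀`
  obtain ⟨r, hr, hrT⟩ := Metric.isOpen_iff.1 Φ.open_target _ htgt
  obtain ⟨r', hr', hrS⟩ := Metric.isOpen_iff.1 Φ.open_source _ hsrc
  rw [hΨ₀] at hrT
  -- the track
  set g : ℝ → ℝ × (ℝ × ℝ) := fun t ↦ Φ.symm (t, 0) with hg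
  have hmemT : ∀ t, |t - t₀| < r → ((t, (0 : ℝ × ℝ)) : ℝ × (ℝ × ℝ)) ∈ Φ.target := fun t ht ↦
    hrT (by
      rw [mem_ball, Prod.dist_eq, dist_self, Real.dist_eq]
      exact max_lt ht (lt_of_le_of_lt le_rfl (lt_of_le_of_lt (abs_nonneg _) ht)))
  have hg_eq : ∀ t, |t - t₀| < r → psi γ (g t) = (t, 0) := fun t ht ↦ by
    rw [← hΦf]
    exact Φ.right_inv (hmemT t ht)
  have hg_src : ∀ t, |t - t₀| < r → g t ∈ Φ.source := fun t ht ↦ Φ.map_target (hmemT t ht)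
  have hg₀ : g t₀ = p₀ := by
    have := Φ.left_inv hsrc
    rwa [hΦf, hΨ₀] at this
  have hg1 : ∀ t, |t - t₀| < r → (g t).1 = t := fun t ht ↦ by
    have := congrArg Prod.fst (hg_eq t ht)
    exact this
  have hg2 : ∀ t, |t - t₀| < r → γ t (g t).2.1 = γ t (g t).2.2 := fun t ht ↦ by
    have h := congrArg Prod.snd (hg_eq t ht)
    simp only [psi] at h
    rw [hg1 t ht] at h
    exact sub_eq_zero.1 h
  -- continuity of the track on `|t - t₀| < r`
  have hg_cont : ContinuousOn g (Ioo (t₀ - r) (t₀ + r)) := by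
    refine Φ.continuousOn_symm.comp (Continuous.continuousOn (by fun_prop)) fun t ht ↦ hmemT t ?_
    rw [abs_sub_lt_iff]
    constructor <;> linarith [ht.1, ht.2]
  -- differentiability of the track at `t₀`: the local inverse has derivative `E.symm` at `(t₀, 0)`
  set E : (ℝ × (ℝ × ℝ)) ≃L[ℝ] (ℝ × (ℝ × ℝ)) := psiDerivEquiv hγ hn hdet with hE
  have hsymm : HasStrictFDerivAt Φ.symm ((E.symm : (ℝ × (ℝ × ℝ)) ≃L[ℝ] (ℝ × (ℝ × ℝ))) :
      ℝ × (ℝ × ℝ) →L[ℝ] ℝ × (ℝ × ℝ)) ((t₀, 0) : ℝ × (ℝ × ℝ)) := by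
    have h := hΨ.to_localInverse
    rw [HasStrictFDerivAt.localInverse_def, hΨ₀] at h
    exact h
  set v : ℝ × (ℝ × ℝ) := E.symm ((1 : ℝ), (0 : ℝ × ℝ)) with hv
  have hgd : HasDerivAt g v t₀ := by
    have hl : HasDerivAt (fun t : ℝ ↦ ((t, (0 : ℝ × ℝ)) : ℝ × (ℝ × ℝ))) ((1 : ℝ), (0 : ℝ × ℝ)) t₀ :=
      (hasDerivAt_id t₀).prodMk (hasDerivAt_const t₀ (0 : ℝ × ℝ))
    exact hsymm.hasFDerivAt.comp_hasDerivAt t₀ hl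
  have hσd : HasDerivAt (fun t ↦ (g t).2.1) v.2.1 t₀ :=
    ((ContinuousLinearMap.fst ℝ ℝ ℝ).comp
      (ContinuousLinearMap.snd ℝ ℝ (ℝ × ℝ))).hasFDerivAt.comp_hasDerivAt t₀ hgd
  have hυd : HasDerivAt (fun t ↦ (g t).2.2) v.2.2 t₀ :=
    ((ContinuousLinearMap.snd ℝ ℝ ℝ).comp
      (ContinuousLinearMap.snd ℝ ℝ (ℝ × ℝ))).hasFDerivAt.comp_hasDerivAt t₀ hgd
  -- the linearised equation `psiDeriv γ p₀ v = (1, 0)` in terms of partial derivatives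
  have hEv : psiDeriv γ p₀ v = ((1 : ℝ), (0 : ℝ × ℝ)) := by
    have h := E.apply_symm_apply ((1 : ℝ), (0 : ℝ × ℝ))
    rw [← hv] at h
    rwa [← coe_psiDerivEquiv hγ hn hdet]
  have hv1 : v.1 = 1 := by
    have h := congrArg Prod.fst hEv
    rwa [psiDeriv_apply] at h
  have hdiff : ∀ s, DifferentiableAt ℝ (uncurry γ) (t₀, s) := fun s ↦ (hγ.differentiable hn) _
  have hsplit : ∀ s ξ, fderiv ℝ (uncurry γ) (t₀, s) (1, ξ)
      = deriv (fun t ↦ γ t s) t₀ + ξ • deriv (γ t₀) s := by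
    intro s ξ
    have h1 : ((1 : ℝ), ξ) = ((1 : ℝ), (0 : ℝ)) + ((0 : ℝ), ξ) := by simp
    rw [h1, map_add, fderiv_uncurry_apply_zero hγ hn]
    congr 1
    have h2 := (Literature.Analysis.Calculus.hasDerivAt_curry_left (q := (t₀, s)) (hdiff s)).deriv
    exact h2.symm
  have hrel : deriv (fun t ↦ γ t a) t₀ + v.2.1 • deriv (γ t₀) a
      = deriv (fun t ↦ γ t b) t₀ + v.2.2 • deriv (γ t₀) b := by
    have h := congrArg Prod.snd hEv
    rw [psiDeriv_apply] at h
    simp only at h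
    rw [hv1, hsplit, hsplit, sub_eq_zero] at h
    exact h
  refine ⟨min r r', fun t ↦ (g t).2.1, fun t ↦ (g t).2.2, v.2.1, v.2.2, lt_min hr hr', ?_, ?_, ?_,
    ?_, hσd, hυd, hrel, ?_, ?_⟩
  · refine (continuous_fst.comp continuous_snd).comp_continuousOn (hg_cont.mono ?_)
    exact Ioo_subset_Ioo (by linarith [min_le_left r r']) (by linarith [min_le_left r r'])
  · refine (continuous_snd.comp continuous_snd).comp_continuousOn (hg_cont.mono ?_)
    exact Ioo_subset_Ioo (by linarith [min_le_left r r']) (by linarith [min_le_left r r'])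
  · simp only [hg₀, hp₀]
  · simp only [hg₀, hp₀]
  · intro t ht
    exact hg2 t (lt_of_lt_of_le ht (min_le_left _ _))
  · intro t s u ht hs hu hsu
    have htr : |t - t₀| < r := lt_of_lt_of_le ht (min_le_left _ _)
    have hq : ((t, (s, u)) : ℝ × (ℝ × ℝ)) ∈ Φ.source := hrS (by
      rw [mem_ball, Prod.dist_eq, Prod.dist_eq, Real.dist_eq, Real.dist_eq, Real.dist_eq]
      exact max_lt (lt_of_lt_of_le ht (min_le_right _ _))
        (max_lt (lt_of_lt_of_le hs (min_le_right _ _)) (lt_of_lt_of_le hu (min_le_right _ _))))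
    have heq : psi γ (t, (s, u)) = psi γ (g t) := by
      rw [hg_eq t htr]
      simp only [psi, hsu, sub_self]
    have := Φ.injOn hq (hg_src t htr) (by rw [hΦf]; exact heq)
    exact ⟨(congrArg (fun q : ℝ × (ℝ × ℝ) ↦ q.2.1) this :), (congrArg (fun q : ℝ × (ℝ × ℝ) ↦ q.2.2) this :)⟩

end Literature.Topology.FourManifolds
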